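import Mathlib
import Summits.ValiantsHypothesis.ValiantsHypothesis.Theses.StableRankCancellation
import HarnessLib

/-!
# Route StableRankCancellation — design tensors: counting lemmas (helpers for item stmt-ValiantsHypothesis-10611)

Helpers for `DesignFlat` (the item itself is closed in `StableRankCancellationDesignFlat.lean`, which
imports this file). For `q` prime, `k ≤ d ≤ q` and the Reed–Solomon design polynomial
`NW = Σ_{cf : Fin k → 𝔽_q} ∏_{j<d} x_{j, p_cf(j)}` (`p_cf(j) = Σ_i cf_i j^i`):

* `card_filter_agree_le` — the coefficient vectors `cf` whose polynomial takes prescribed values at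
  the nodes of `T ⊆ Fin d` number `≤ q^{k − min(k,|T|)}` (Lagrange interpolation is onto the value
  tables on `≤ k` distinct nodes; rank–nullity over `𝔽_q`; a fibre is a translate of the kernel);
* `coeffMat_designPoly` — the entry `(r, c)` of the tree's cut matrix `coeffMat ℂ S Sᶜ NW` is the
  NUMBER of `cf` whose value table restricts to `r` on `S` and to `c` on `Sᶜ`;
* `sum_card_agree_row/col`, `sum_sum_card_agree`, `card_agree_row_le/col_le` — row sums, column
  sums (`≤ q^{k − min(k,|S|)}`, `≤ q^{k − min(k,|Sᶜ|)}`) and total mass `q^k` of that count matrix.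

Honest framing: unconditional combinatorics filed as route bookkeeping; nothing here is progress on
VP ≠ VNP.

## References

* N. Nisan, A. Wigderson, *Hardness vs randomness*, JCSS 49 (1994) — the polynomial (Reed–Solomon)
  designs. [cite: NisanWigderson1994, §2]
* N. Kayal, C. Saha, R. Saptharishi, *A super-polynomial lower bound for regular arithmetic
  formulas*, STOC 2014 — the design polynomial `NW`. [cite: KayalSahaSaptharishi2014, §1]
-/

set_option linter.dupNamespace false

noncomputable section

open Finset MvPolynomial

namespace Summit.ValiantsHypothesis.ValiantsHypothesis.Theorems.StableRankCancellationDesign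

open Literature.Computability.AlgebraicComplexity

/-! ### §1 Counting polynomials of degree `< k` with prescribed values -/

section Counting

variable {q : ℕ} [Fact q.Prime]

/-- The evaluation of coefficient vectors of length `k` at the nodes of `T` is a linear map.
[folklore] -/
theorem exists_evalMap (k d : ℕ) (T : Finset (Fin d)) :
    ∃ L : (Fin k → ZMod q) →ₗ[ZMod q] (T → ZMod q),
      ∀ cf j, L cf j = ∑ i : Fin k, cf i * ((j : Fin d) : ℕ) ^ (i : ℕ) := by
  refine ⟨{ toFun := fun cf j => ∑ i : Fin k, cf i * (((j : Fin d) : ℕ) : ZMod q) ^ (i : ℕ)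
            map_add' := fun x y => by
              funext j; simp only [Pi.add_apply, add_mul, sum_add_distrib]
            map_smul' := fun c x => by
              funext j; simp only [Pi.smul_apply, smul_eq_mul, RingHom.id_apply, mul_sum, mul_assoc] },
    fun cf j => ?_⟩
  rfl

/-- The nodes `j ↦ (j : ZMod q)`, `j < d ≤ q`, are pairwise distinct. [folklore] -/
theorem natCast_injOn_fin {d : ℕ} (hdq : d ≤ q) :
    Set.InjOn (fun j : Fin d => ((j : ℕ) : ZMod q)) Set.univ := by
  intro j _ j' _ h
  have hq : 0 < q := (Fact.out : q.Prime).pos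
  haveI : NeZero q := ⟨hq.ne'⟩
  have hj : (((j : ℕ) : ZMod q)).val = j := ZMod.val_cast_of_lt (lt_of_lt_of_le j.isLt hdq)
  have hj' : (((j' : ℕ) : ZMod q)).val = j' := ZMod.val_cast_of_lt (lt_of_lt_of_le j'.isLt hdq)
  have := congrArg ZMod.val h
  simp only at this
  rw [hj, hj'] at this
  exact Fin.ext this

/-- **Lagrange**: with `|T| ≤ k` distinct nodes, every value table on `T` is attained by a
coefficient vector of length `k`. [folklore] -/
theorem evalMap_surjective {k d : ℕ} (hdq : d ≤ q) (T : Finset (Fin d)) (hT : T.card ≤ k)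
    (L : (Fin k → ZMod q) →ₗ[ZMod q] (T → ZMod q))
    (hL : ∀ cf j, L cf j = ∑ i : Fin k, cf i * ((j : Fin d) : ℕ) ^ (i : ℕ)) :
    Function.Surjective L := by
  intro w
  classical
  -- extend `w` to all of `Fin d` and interpolate
  set w' : Fin d → ZMod q := fun j => if h : j ∈ T then w ⟨j, h⟩ else 0 with hw'
  set p : Polynomial (ZMod q) :=
    Lagrange.interpolate T (fun j : Fin d => ((j : ℕ) : ZMod q)) w' with hp
  have hinj : Set.InjOn (fun j : Fin d => ((j : ℕ) : ZMod q)) (T : Set (Fin d)) :=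
    (natCast_injOn_fin hdq).mono (Set.subset_univ _)
  have hdeg : p.degree < (T.card : WithBot ℕ) := by
    have := Lagrange.degree_interpolate_lt (r := w') hinj
    exact_mod_cast this
  refine ⟨fun i => p.coeff i, funext fun j => ?_⟩
  rw [hL]
  -- `Σ_{i<k} coeff i · j^i = p.eval j`
  have hnat : p = 0 ∨ p.natDegree < k := by
    by_cases h0 : p = 0
    · exact Or.inl h0
    · right
      have := (Polynomial.natDegree_lt_iff_degree_lt h0).2 hdeg
      omega
  have heval : ∑ i : Fin k, p.coeff i * (((j : Fin d) : ℕ) : ZMod q) ^ (i : ℕ) =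
      p.eval (((j : Fin d) : ℕ) : ZMod q) := by
    rcases hnat with h0 | hlt
    · simp [h0]
    · rw [Polynomial.eval_eq_sum_range' hlt, ← Fin.sum_univ_eq_sum_range]
  rw [heval, hp, Lagrange.eval_interpolate_at_node (r := w') hinj j.2, hw']
  simp only [dif_pos j.2]

/-- **Counting lemma**: the coefficient vectors `cf : Fin k → 𝔽_q` whose polynomial takes
prescribed values at the nodes of `T ⊆ Fin d` (`k ≤ d ≤ q`) number at most `q^{k − min(k,|T|)}`.
[folklore] -/
theorem card_filter_agree_le {k d : ℕ} (hdq : d ≤ q) (T : Finset (Fin d))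
    (v : Fin d → ZMod q) :
    (univ.filter fun cf : Fin k → ZMod q =>
        ∀ j ∈ T, ∑ i : Fin k, cf i * ((j : ℕ) : ZMod q) ^ (i : ℕ) = v j).card ≤
      q ^ (k - min k T.card) := by
  classical
  have hq : 0 < q := (Fact.out : q.Prime).pos
  -- shrink `T` to `T'` with `|T'| = min k |T|`
  obtain ⟨T', hT'T, hT'⟩ := exists_subset_card_eq (min_le_right k T.card)
  have hT'k : T'.card ≤ k := hT' ▸ min_le_left _ _
  refine (card_le_card (s := univ.filter fun cf : Fin k → ZMod q =>
      ∀ j ∈ T, ∑ i : Fin k, cf i * ((j : ℕ) : ZMod q) ^ (i : ℕ) = v j)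
    (t := univ.filter fun cf : Fin k → ZMod q =>
      ∀ j ∈ T', ∑ i : Fin k, cf i * ((j : ℕ) : ZMod q) ^ (i : ℕ) = v j) ?_).trans ?_
  · intro cf
    simp only [mem_filter, mem_univ, true_and]
    exact fun h j hj => h j (hT'T hj)
  rw [← hT']
  -- the evaluation map at `T'` and its kernel
  obtain ⟨L, hL⟩ := exists_evalMap (q := q) k d T'
  have hsurj := evalMap_surjective hdq T' hT'k L hL
  -- rank–nullity: `|ker L| · q^{|T'|} = q^k`
  have hker : Nat.card (LinearMap.ker L) = q ^ (k - T'.card) := by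
    have h1 := Submodule.card_eq_card_quotient_mul_card (LinearMap.ker L)
    have h2 : Nat.card ((Fin k → ZMod q) ⧸ LinearMap.ker L) = q ^ T'.card := by
      rw [Nat.card_congr (L.quotKerEquivOfSurjective hsurj).toEquiv, Nat.card_fun, Nat.card_zmod,
        Nat.card_eq_fintype_card, Fintype.card_coe]
    rw [h2, Nat.card_fun, Nat.card_zmod, Nat.card_eq_fintype_card, Fintype.card_fin] at h1
    have h3 : Nat.card (LinearMap.ker L) = q ^ k / q ^ T'.card :=
      (Nat.div_eq_of_eq_mul_left (pow_pos hq _) h1).symm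
    rw [h3, Nat.pow_div hT'k hq]
  -- the fibre over `v|_{T'}` is empty or a translate of the kernel
  set E := univ.filter fun cf : Fin k → ZMod q =>
      ∀ j ∈ T', ∑ i : Fin k, cf i * ((j : ℕ) : ZMod q) ^ (i : ℕ) = v j with hE
  have hEiff : ∀ cf, cf ∈ E ↔ L cf = fun j : T' => v j := by
    intro cf
    rw [hE, mem_filter]
    simp only [mem_univ, true_and]
    constructor
    · intro h; funext j; rw [hL]; exact h j j.2
    · intro h j hj
      have := congrFun h ⟨j, hj⟩
      rw [hL] at this
      exact this
  rcases E.eq_empty_or_nonempty with hempty | ⟨cf₀, hcf₀⟩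
  · rw [hempty, card_empty]; exact Nat.zero_le _
  · have h0 : L cf₀ = fun j : T' => v j := (hEiff cf₀).1 hcf₀
    have hK : Nat.card (LinearMap.ker L) =
        (univ.filter fun x : Fin k → ZMod q => L x = 0).card := by
      rw [Nat.card_eq_fintype_card, ← Fintype.card_subtype]
      exact Fintype.card_congr (Equiv.subtypeEquivRight fun x => LinearMap.mem_ker)
    rw [← hker, hK]
    refine card_le_card_of_injOn (fun cf => cf - cf₀) (fun cf hcf => ?_) ?_
    · simp only [mem_coe, mem_filter, mem_univ, true_and]
      rw [map_sub, (hEiff cf).1 hcf, h0, sub_self]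
    · intro x _ y _ h
      exact sub_left_inj.1 h

end Counting

/-! ### §2 The coefficient matrix of the design polynomial counts agreeing coefficient vectors -/

section Coefficients

variable {q : ℕ} [Fact q.Prime] {d k : ℕ}

omit [Fact q.Prime] in
/-- Values of the exponent vector `Σ_j e_{(j, P j)}` of a value table `P : Fin d → 𝔽_q`. [folklore] -/
theorem tableMonomial_apply (P : Fin d → ZMod q) (i : Fin d) (x : ZMod q) :
    (∑ j : Fin d, Finsupp.single (⟨j, P j⟩ : Σ _ : Fin d, ZMod q) 1) ⟨i, x⟩ =
      if P i = x then 1 else 0 := by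
  rw [Finsupp.finsetSum_apply]
  simp only [Finsupp.single_apply, Sigma.mk.inj_iff, heq_eq_eq]
  simp_rw [ite_and]
  rw [Finset.sum_ite_eq' univ i]
  simp

omit [Fact q.Prime] in
/-- The table monomial of `P` is the glued assignment monomial of `(r, c)` on `(S, Sᶜ)` iff `P`
restricts to `r` on `S` and to `c` on `Sᶜ`. [folklore] -/
theorem tableMonomial_eq_iff (P : Fin d → ZMod q) (S : Finset (Fin d))
    (r : Assignment (fun _ : Fin d => ZMod q) S) (c : Assignment (fun _ : Fin d => ZMod q) Sᶜ) :
    (∑ j : Fin d, Finsupp.single (⟨j, P j⟩ : Σ _ : Fin d, ZMod q) 1) =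
        assignMonomial S r + assignMonomial Sᶜ c ↔
      (r = fun j : S => P j) ∧ (c = fun j : ↥(Sᶜ) => P j) := by
  constructor
  · intro h
    constructor
    · funext j
      have hj : (j : Fin d) ∉ Sᶜ := fun h' => (mem_compl.1 h') j.2
      have := DFunLike.congr_fun h ⟨j, r j⟩
      rw [tableMonomial_apply, Finsupp.add_apply, assignMonomial_apply, dif_pos j.2,
        assignMonomial_apply_of_notMem _ _ _ hj] at this
      simp only [if_true, add_zero] at this
      by_contra hne
      rw [if_neg (fun h' => hne h'.symm)] at this
      exact zero_ne_one this
    · funext j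
      have hj : (j : Fin d) ∉ S := mem_compl.1 j.2
      have := DFunLike.congr_fun h ⟨j, c j⟩
      rw [tableMonomial_apply, Finsupp.add_apply, assignMonomial_apply_of_notMem _ _ _ hj,
        assignMonomial_apply, dif_pos j.2] at this
      simp only [if_true, zero_add] at this
      by_contra hne
      rw [if_neg (fun h' => hne h'.symm)] at this
      exact zero_ne_one this
  · rintro ⟨hr, hc⟩
    ext ⟨i, x⟩
    rw [tableMonomial_apply, Finsupp.add_apply]
    by_cases hi : i ∈ S
    · have hi' : i ∉ Sᶜ := fun h' => (mem_compl.1 h') hi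
      rw [assignMonomial_apply, dif_pos hi, assignMonomial_apply_of_notMem _ _ _ hi', add_zero, hr]
    · have hi' : i ∈ Sᶜ := mem_compl.2 hi
      rw [assignMonomial_apply_of_notMem _ _ _ hi, assignMonomial_apply, dif_pos hi', zero_add, hc]

/-- **Entries of `M_S(NW)`**: the coefficient of the glued monomial of `(r, c)` in the design
polynomial is the number of coefficient vectors `cf` whose value table restricts to `r` on `S` and
to `c` on `Sᶜ`. [folklore] -/
theorem coeffMat_designPoly (S : Finset (Fin d))
    (r : Assignment (fun _ : Fin d => ZMod q) S) (c : Assignment (fun _ : Fin d => ZMod q) Sᶜ) :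
    coeffMat ℂ S Sᶜ (∑ cf : Fin k → ZMod q, ∏ j : Fin d,
        (X (⟨j, ∑ i : Fin k, cf i * ((j : ℕ) : ZMod q) ^ (i : ℕ)⟩ : Σ _ : Fin d, ZMod q) :
          MvPolynomial (Σ _ : Fin d, ZMod q) ℂ)) r c =
      ((univ.filter fun cf : Fin k → ZMod q =>
          (r = fun j : S => ∑ i : Fin k, cf i * (((j : Fin d) : ℕ) : ZMod q) ^ (i : ℕ)) ∧
          (c = fun j : ↥(Sᶜ) => ∑ i : Fin k, cf i * (((j : Fin d) : ℕ) : ZMod q) ^ (i : ℕ))).card : ℂ) := by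
  classical
  have hprod : ∀ cf : Fin k → ZMod q, (∏ j : Fin d,
      (X (⟨j, ∑ i : Fin k, cf i * ((j : ℕ) : ZMod q) ^ (i : ℕ)⟩ : Σ _ : Fin d, ZMod q) :
        MvPolynomial (Σ _ : Fin d, ZMod q) ℂ)) =
      monomial (∑ j : Fin d, Finsupp.single
        (⟨j, ∑ i : Fin k, cf i * ((j : ℕ) : ZMod q) ^ (i : ℕ)⟩ : Σ _ : Fin d, ZMod q) 1) 1 := by
    intro cf
    rw [monomial_sum_one]
    rfl
  rw [coeffMat_apply, coeff_sum]
  simp_rw [hprod, coeff_monomial]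
  rw [Finset.sum_boole]
  congr 1
  exact congrArg Finset.card (Finset.filter_congr fun cf _ => tableMonomial_eq_iff _ S r c)

/-- Row sums of the count matrix: fixing `r`, summing over `c` counts the `cf` agreeing with `r`
on `S`. [folklore] -/
theorem sum_card_agree_row (S : Finset (Fin d)) (r : Assignment (fun _ : Fin d => ZMod q) S) :
    ∑ c : Assignment (fun _ : Fin d => ZMod q) Sᶜ,
      (univ.filter fun cf : Fin k → ZMod q =>
          (r = fun j : S => ∑ i : Fin k, cf i * (((j : Fin d) : ℕ) : ZMod q) ^ (i : ℕ)) ∧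
          (c = fun j : ↥(Sᶜ) => ∑ i : Fin k, cf i * (((j : Fin d) : ℕ) : ZMod q) ^ (i : ℕ))).card =
      (univ.filter fun cf : Fin k → ZMod q =>
          r = fun j : S => ∑ i : Fin k, cf i * (((j : Fin d) : ℕ) : ZMod q) ^ (i : ℕ)).card := by
  classical
  simp_rw [card_filter]
  rw [sum_comm]
  refine sum_congr rfl fun cf _ => ?_
  simp_rw [ite_and]
  split_ifs with h
  · rw [Finset.sum_ite_eq' univ]
    simp
  · simp

/-- Column sums of the count matrix. [folklore] -/
theorem sum_card_agree_col (S : Finset (Fin d)) (c : Assignment (fun _ : Fin d => ZMod q) Sᶜ) :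
    ∑ r : Assignment (fun _ : Fin d => ZMod q) S,
      (univ.filter fun cf : Fin k → ZMod q =>
          (r = fun j : S => ∑ i : Fin k, cf i * (((j : Fin d) : ℕ) : ZMod q) ^ (i : ℕ)) ∧
          (c = fun j : ↥(Sᶜ) => ∑ i : Fin k, cf i * (((j : Fin d) : ℕ) : ZMod q) ^ (i : ℕ))).card =
      (univ.filter fun cf : Fin k → ZMod q =>
          c = fun j : ↥(Sᶜ) => ∑ i : Fin k, cf i * (((j : Fin d) : ℕ) : ZMod q) ^ (i : ℕ)).card := by
  classical
  simp_rw [card_filter]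
  rw [sum_comm]
  refine sum_congr rfl fun cf _ => ?_
  simp_rw [ite_and]
  rw [Finset.sum_ite_eq' univ]
  simp

/-- Total mass of the count matrix: every `cf` is counted exactly once, so the entries sum to
`q^k`. [folklore] -/
theorem sum_sum_card_agree (S : Finset (Fin d)) :
    ∑ r : Assignment (fun _ : Fin d => ZMod q) S, ∑ c : Assignment (fun _ : Fin d => ZMod q) Sᶜ,
      (univ.filter fun cf : Fin k → ZMod q =>
          (r = fun j : S => ∑ i : Fin k, cf i * (((j : Fin d) : ℕ) : ZMod q) ^ (i : ℕ)) ∧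
          (c = fun j : ↥(Sᶜ) => ∑ i : Fin k, cf i * (((j : Fin d) : ℕ) : ZMod q) ^ (i : ℕ))).card =
      q ^ k := by
  classical
  simp_rw [sum_card_agree_row, card_filter]
  rw [sum_comm]
  simp_rw [Finset.sum_ite_eq' univ]
  simp [ZMod.card]

/-- A row sum is the number of polynomials of degree `< k` with `|S|` prescribed values:
`≤ q^{k − min(k,|S|)}`. [folklore] -/
theorem card_agree_row_le (hdq : d ≤ q) (S : Finset (Fin d))
    (r : Assignment (fun _ : Fin d => ZMod q) S) :
    (univ.filter fun cf : Fin k → ZMod q =>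
        r = fun j : S => ∑ i : Fin k, cf i * (((j : Fin d) : ℕ) : ZMod q) ^ (i : ℕ)).card ≤
      q ^ (k - min k S.card) := by
  classical
  refine (card_le_card ?_).trans
    (card_filter_agree_le (k := k) hdq S (fun j => if h : j ∈ S then r ⟨j, h⟩ else 0))
  intro cf
  simp only [mem_filter, mem_univ, true_and]
  intro h j hj
  rw [dif_pos hj, h]

/-- A column sum is `≤ q^{k − min(k,|Sᶜ|)}`. [folklore] -/
theorem card_agree_col_le (hdq : d ≤ q) (S : Finset (Fin d))
    (c : Assignment (fun _ : Fin d => ZMod q) Sᶜ) :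
    (univ.filter fun cf : Fin k → ZMod q =>
        c = fun j : ↥(Sᶜ) => ∑ i : Fin k, cf i * (((j : Fin d) : ℕ) : ZMod q) ^ (i : ℕ)).card ≤
      q ^ (k - min k (d - S.card)) := by
  classical
  have hc : Sᶜ.card = d - S.card := by rw [card_compl, Fintype.card_fin]
  rw [← hc]
  refine (card_le_card ?_).trans
    (card_filter_agree_le (k := k) hdq Sᶜ (fun j => if h : j ∈ Sᶜ then c ⟨j, h⟩ else 0))
  intro cf
  simp only [mem_filter, mem_univ, true_and]
  intro h j hj
  rw [dif_pos hj, h]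

end Coefficients

end Summit.ValiantsHypothesis.ValiantsHypothesis.Theorems.StableRankCancellationDesign

end
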